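import Mathlib.Algebra.Module.ZLattice.Basic
import Mathlib.Algebra.Module.ZLattice.Covolume
import Mathlib.Analysis.InnerProductSpace.PiL2
import HarnessLib

-- provenance: harness21/H21/H21/Prelude/Lattice/SuccessiveMinima.lean @ 8d3e2f0 (interim HEAD d8f2665); M5 mechanical rewrite
/-!
# Successive minima, minimum distance and the Hermite constant

Trunk: Lattice (item `SuccessiveMinima`, concept C1 of the Lattice outline).

For a `ℤ`-submodule `L` of a real normed space `E` we define

* `Literature.Lattice.minNorm L` : the minimum distance `λ₁(L)`, the infimum of the norms of the nonzero
  vectors of `L`;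
* `Literature.Lattice.successiveMinimum L i` : the `i`-th successive minimum `λᵢ(L)`, the infimum of the
  radii `r ≥ 0` such that the closed ball of radius `r` contains `i` `ℝ`-linearly independent
  vectors of `L` (Cassels, *An Introduction to the Geometry of Numbers*, Ch. VIII §1;
  Peikert, *A decade of lattice cryptography* (2016), §2.2.1);
* `Literature.Lattice.hermiteSet n`, `Literature.Lattice.hermiteConstant n` : the Hermite constant `γₙ`, the
  supremum over full-rank lattices `L ⊆ ℝⁿ` of `λ₁(L)² / covol(L)^{2/n}`
  (Cassels, op. cit., Ch. II §3; Conway–Sloane, *SPLAG*, Ch. 1 §1.4).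

None of these notions exists in Mathlib (searched: `successiveMinim`, `Hermite`, `minNorm`,
`shortest`); Mathlib provides the anchors `IsZLattice`, `ZLattice.covolume`, `Metric.closedBall`,
`Module.finrank`, which we use.

Design choices:
* The definitions require no discreteness: they make sense for any `Submodule ℤ E`; discreteness /
  `IsZLattice` hypotheses appear only in the API lemmas that need them.
* Junk values: `minNorm ⊥ = 0` (infimum of the empty set); `successiveMinimum L 0 = 0`;
  `successiveMinimum L i = 0` when `i` exceeds the `ℝ`-rank of the span of `L` (empty set);
  moreover, since `Module.finrank` is `0` for infinite-dimensional spaces,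
  `successiveMinimum L i = 0` for all `i ≥ 1` whenever `span ℝ L` is infinite-dimensional, so the
  lemmas relating `λᵢ` to `λ₁ = minNorm` carry a `FiniteDimensional ℝ E` hypothesis.
  `hermiteConstant 0 = 0` is a genuine value (the only lattice of the zero space is `⊥`,
  `minNorm ⊥ = 0`).
* Attainment of the minimum (`exists_mem_norm_eq_minNorm`) is stated for a proper space `E`
  (closed balls compact, e.g. `E` finite-dimensional), where balls meet a discrete subgroup in
  finitely many points; it fails in infinite dimension.
* `minNorm L` could equivalently be phrased as `Metric.infDist 0 ((L : Set E) \ {0})`; we record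
  this as `minNorm_eq_infDist`.
* The Hermite constant is stated for `EuclideanSpace ℝ (Fin n)` with its canonical volume.
-/

noncomputable section

open Module Metric

namespace Literature.Algebra.EuclideanLattices

variable {E : Type*} [NormedAddCommGroup E]

/-- The *minimum distance* `λ₁(L)` of a `ℤ`-submodule `L` of a real normed space: the infimum of
`‖x‖` over the nonzero `x ∈ L`. Junk value `0` when `L = ⊥` (the set is empty).
Ref: Cassels, *Geometry of Numbers*, Ch. VIII §1; Peikert (2016), §2.2.1.
[cite: PeikertDecade2016, §2.2.1] -/
def minNorm (L : Submodule ℤ E) : ℝ :=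
  sInf ((‖·‖) '' {x : E | x ∈ L ∧ x ≠ 0})

/-- `λ₁(L) ≥ 0`. Ref: Cassels, *Geometry of Numbers*, Ch. VIII §1. [folklore] -/
theorem minNorm_nonneg (L : Submodule ℤ E) : 0 ≤ minNorm L := by
  refine Real.sInf_nonneg ?_
  rintro _ ⟨x, -, rfl⟩
  exact norm_nonneg x

/-- A nonzero discrete subgroup has positive minimum distance.
Ref: Cassels, *Geometry of Numbers*, Ch. III §4. [cite: Cassels1997, Ch. III §4] -/
def minNorm_pos : Prop :=
  ∀ (L : Submodule ℤ E) [DiscreteTopology L] (hL : L ≠ ⊥),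
    0 < minNorm L

/-- `minNorm L` is the distance from `0` to the set of nonzero vectors of `L`
(same junk value `0` for `L = ⊥`). Ref: Cassels, *Geometry of Numbers*, Ch. VIII §1.
[cite: Cassels1997, Ch. VIII §1] -/
def minNorm_eq_infDist : Prop :=
  ∀ (L : Submodule ℤ E),
    minNorm L = infDist (0 : E) ((L : Set E) \ {0})

/-- The minimum distance of a nonzero discrete subgroup of a proper normed group (e.g. a
finite-dimensional real normed space) is attained by some nonzero lattice vector: closed balls are
compact, hence meet the discrete closed subgroup `L` in finitely many points. (False without
properness: in an infinite-dimensional Hilbert space the infimum need not be attained.)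
Ref: Cassels, *Geometry of Numbers*, Ch. III §4 / Ch. VIII §1. [cite: Cassels1997, Ch. III §4] -/
def exists_mem_norm_eq_minNorm : Prop :=
  ∀ (L : Submodule ℤ E) [ProperSpace E] [DiscreteTopology L] (hL : L ≠ ⊥),
    ∃ x ∈ L, x ≠ 0 ∧ ‖x‖ = minNorm L

variable [NormedSpace ℝ E]

/-- The `i`-th *successive minimum* `λᵢ(L)` of a `ℤ`-submodule `L` of a real normed space: the
infimum of the radii `r ≥ 0` such that the vectors of `L` of norm at most `r` span an `ℝ`-subspace
of dimension at least `i`, i.e. the closed ball of radius `r` contains `i` linearly independent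
vectors of `L`. Junk value `0` for `i = 0` and for `i` larger than the rank of `L` (empty set);
also, by the `Module.finrank = 0` convention for infinite-dimensional spaces, `λᵢ(L) = 0` for all
`i ≥ 1` whenever `span ℝ L` is infinite-dimensional (the intended use is `E` finite-dimensional).
Ref: Cassels, *Geometry of Numbers*, Ch. VIII §1; Peikert (2016), §2.2.1.
[cite: PeikertDecade2016, §2.2.1] -/
def successiveMinimum (L : Submodule ℤ E) (i : ℕ) : ℝ :=
  sInf {r : ℝ | 0 ≤ r ∧
    i ≤ finrank ℝ (Submodule.span ℝ ((L : Set E) ∩ closedBall (0 : E) r))}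

/-- The set of Hermite invariants `λ₁(L)² / covol(L)^{2/n}` of all full-rank lattices
`L ⊆ ℝⁿ` (with the canonical Lebesgue volume on `EuclideanSpace ℝ (Fin n)`); its supremum is the
Hermite constant `γₙ`. For `n = 0` the exponent `2 / (n : ℝ)` is `0` (so the denominator is `1`),
the only lattice of the zero space is `⊥` and `minNorm ⊥ = 0`, whence `hermiteSet 0 = {0}`.
Ref: Cassels, *Geometry of Numbers*, Ch. II §3. [folklore] -/
def hermiteSet (n : ℕ) : Set ℝ :=
  {c : ℝ | ∃ (L : Submodule ℤ (EuclideanSpace ℝ (Fin n))) (_ : DiscreteTopology L)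
    (_ : IsZLattice ℝ L), c = minNorm L ^ 2 / ZLattice.covolume L ^ (2 / (n : ℝ))}

/-- The *Hermite constant* `γₙ = sup_L λ₁(L)² / covol(L)^{2/n}`, the supremum ranging over
full-rank lattices `L ⊆ ℝⁿ`. For `n = 0`, `γ₀ = 0` since the only lattice of the zero space is
`⊥` and `minNorm ⊥ = 0` (so `hermiteSet 0 = {0}`); the value would be the junk `0` if the set were
unbounded (it is bounded, see `bddAbove_hermiteSet`).
Ref: Cassels, *Geometry of Numbers*, Ch. II §3; Conway–Sloane, *SPLAG*, Ch. 1 §1.4. [folklore] -/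
def hermiteConstant (n : ℕ) : ℝ :=
  sSup (hermiteSet n)

/-! ### Basic API -/

/-- `λᵢ(L) ≥ 0`. Ref: Cassels, *Geometry of Numbers*, Ch. VIII §1. [folklore] -/
theorem successiveMinimum_nonneg (L : Submodule ℤ E) (i : ℕ) : 0 ≤ successiveMinimum L i :=
  Real.sInf_nonneg fun _ hr => hr.1

/-- Junk value: `λ₀(L) = 0`. Ref: Cassels, *Geometry of Numbers*, Ch. VIII §1 (convention).
[folklore] -/
theorem successiveMinimum_zero (L : Submodule ℤ E) : successiveMinimum L 0 = 0 :=
  le_antisymm (csInf_le ⟨0, fun _ h => h.1⟩ ⟨le_rfl, Nat.zero_le _⟩) (successiveMinimum_nonneg L 0)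

/-- In a finite-dimensional space, `λ₁(L)` as first successive minimum agrees with the minimum
distance `minNorm L`; no discreteness hypothesis is needed (both sides are the same infimum).
Finite-dimensionality is needed: otherwise `finrank` of an infinite-dimensional span is `0` and
the left-hand side is the junk value `0`. Ref: Peikert (2016), §2.2.1.
[cite: PeikertDecade2016, §2.2.1] -/
def successiveMinimum_one_eq_minNorm : Prop :=
  ∀ [FiniteDimensional ℝ E] (L : Submodule ℤ E),
    successiveMinimum L 1 = minNorm L

/-- Monotonicity `λᵢ(L) ≤ λⱼ(L)` for `i ≤ j` not exceeding the `ℝ`-rank of the span of `L`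
(the upper bound on `j` avoids the junk value `0`; when `span ℝ L` is infinite-dimensional the
bound forces `i = j = 0` and the statement is trivial). Ref: Cassels, *Geometry of Numbers*,
Ch. VIII §1. [cite: Cassels1997, Ch. VIII §1] -/
def successiveMinimum_mono : Prop :=
  ∀ (L : Submodule ℤ E) {i j : ℕ} (hij : i ≤ j)
    (hj : j ≤ finrank ℝ (Submodule.span ℝ (L : Set E))),
    successiveMinimum L i ≤ successiveMinimum L j

/-- Characterisation of `λᵢ(L) ≤ r` for a discrete subgroup, `i ≤ rank` and `r ≥ 0`: the closed
ball of radius `r` contains `i` `ℝ`-linearly independent vectors of `L`. The hypothesis `hi'`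
excludes the junk value above the rank; `hr` is needed only for `i = 0` (where the left-hand side
reads `0 ≤ r` and the right-hand side is trivially true; for `i ≥ 1` and `r < 0` both sides are
false); discreteness is needed for `→` (the infimum is attained). This is the signature used by
`Literature.Statements.PQC.LatticeGeometry` (pqc.S11). Ref: Cassels, *Geometry of Numbers*,
Ch. VIII §1; Peikert (2016), §2.2.1. [cite: PeikertDecade2016, §2.2.1] -/
def successiveMinimum_le_iff : Prop :=
  ∀ (L : Submodule ℤ E) [DiscreteTopology L] {i : ℕ}
    (hi' : i ≤ finrank ℝ (Submodule.span ℝ (L : Set E))) {r : ℝ} (hr : 0 ≤ r),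
    successiveMinimum L i ≤ r ↔
      ∃ v : Fin i → E, LinearIndependent ℝ v ∧ ∀ k, v k ∈ L ∧ ‖v k‖ ≤ r

/-- For a full-rank lattice `L` in a finite-dimensional space of dimension `n`, there are `n`
`ℝ`-linearly independent lattice vectors `v₁, …, vₙ` with `‖vᵢ‖ ≤ λᵢ(L)` (indices shifted:
`‖v k‖ ≤ λ_{k+1}(L)` for `k : Fin n`). Ref: Cassels, *Geometry of Numbers*, Ch. VIII §1, Lemma 1.
[cite: Cassels1997, Ch. VIII §1 Lemma 1] -/
def exists_linearIndependent_norm_le_successiveMinimum : Prop :=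
  ∀ (L : Submodule ℤ E) [FiniteDimensional ℝ E] [DiscreteTopology L] [IsZLattice ℝ L],
    ∃ v : Fin (finrank ℝ E) → E, LinearIndependent ℝ v ∧
      ∀ k, v k ∈ L ∧ ‖v k‖ ≤ successiveMinimum L ((k : ℕ) + 1)

/-- The successive minima `λᵢ(L)`, `1 ≤ i ≤ n`, of a full-rank lattice in an `n`-dimensional
space are positive. Ref: Cassels, *Geometry of Numbers*, Ch. VIII §1.
[cite: Cassels1997, Ch. VIII §1] -/
def successiveMinimum_pos : Prop :=
  ∀ (L : Submodule ℤ E) [FiniteDimensional ℝ E] [DiscreteTopology L] [IsZLattice ℝ L] {i : ℕ}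
    (hi : 1 ≤ i) (hi' : i ≤ finrank ℝ E),
    0 < successiveMinimum L i

/-- The Hermite invariants of `n`-dimensional lattices are bounded above (e.g. by Minkowski's
convex body theorem, `γₙ ≤ 4 (Γ(n/2+1))^{2/n} / π`; the cruder bound `γₙ ≤ n` is the downstream
target `hermiteConstant_le` in `Literature.Statements.PQC.LatticeGeometry`). For `n = 0`,
`hermiteSet 0 = {0}`. Ref: Cassels, *Geometry of Numbers*, Ch. II §3 and Ch. IV.
[cite: Cassels1997, Ch. II §3] -/
def bddAbove_hermiteSet : Prop :=
  ∀ (n : ℕ),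
    BddAbove (hermiteSet n)

/-- `γₙ ≥ 0`. Ref: Cassels, *Geometry of Numbers*, Ch. II §3. [folklore] -/
theorem hermiteConstant_nonneg (n : ℕ) : 0 ≤ hermiteConstant n := by
  refine Real.sSup_nonneg ?_
  rintro _ ⟨L, _, _, rfl⟩
  exact div_nonneg (sq_nonneg _)
    (Real.rpow_nonneg (ZLattice.covolume_pos L MeasureTheory.volume).le _)

/-- Definition unfolding: for every full-rank lattice `L ⊆ ℝⁿ`,
`λ₁(L)² ≤ γₙ · covol(L)^{2/n}`. Ref: Cassels, *Geometry of Numbers*, Ch. II §3.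
[cite: Cassels1997, Ch. II §3] -/
def minNorm_sq_le_hermiteConstant_mul : Prop :=
  ∀ {n : ℕ} (L : Submodule ℤ (EuclideanSpace ℝ (Fin n))) [DiscreteTopology L]
    [IsZLattice ℝ L],
    minNorm L ^ 2 ≤ hermiteConstant n * ZLattice.covolume L ^ (2 / (n : ℝ))

/-- Conditional discharge of `minNorm_sq_le_hermiteConstant_mul` from `bddAbove_hermiteSet`:
`λ₁(L)² / covol(L)^{2/n} ∈ hermiteSet n` is at most the supremum `γₙ`.
Ref: Cassels, *Geometry of Numbers*, Ch. II §3. [cite: Cassels1997, Ch. II §3] -/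
theorem minNorm_sq_le_hermiteConstant_mul_of_bddAbove (h : bddAbove_hermiteSet) :
    minNorm_sq_le_hermiteConstant_mul := by
  intro n L _ _
  have hc : 0 < ZLattice.covolume L ^ (2 / (n : ℝ)) :=
    Real.rpow_pos_of_pos (ZLattice.covolume_pos L MeasureTheory.volume) _
  rw [← div_le_iff₀ hc]
  exact le_csSup (h n) ⟨L, ‹_›, ‹_›, rfl⟩


/-! ### Discharges -/

/-- Discharge of `successiveMinimum_one_eq_minNorm`: in a finite-dimensional real normed space,
`λ₁(L)` as first successive minimum equals the minimum distance `minNorm L`, for every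
`ℤ`-submodule `L` (no discreteness needed). Proof: for `r : ℝ`, the span of
`L ∩ closedBall 0 r` has `finrank ≥ 1` iff it is nonzero iff some nonzero `x ∈ L` has `‖x‖ ≤ r`
(`Submodule.one_le_finrank_iff`, `Submodule.span_eq_bot`); hence the set whose infimum defines
`λ₁(L)` is the upward closure of the set of norms of nonzero lattice vectors, and both sets have
the same infimum (both empty, value `0`, when `L = ⊥`). Peikert defines
`λ₁(L) := min_{v ∈ L∖{0}} ‖v‖` and "more generally" `λᵢ(L)` as the smallest `r` such that `L` has
`i` linearly independent vectors of norm at most `r` (A decade of lattice cryptography, §2.2.1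
"Basic Definitions", p. 6 of the author version; the definitions there are unnumbered prose).
[cite: PeikertDecade2016, §2.2.1] -/
theorem successiveMinimum_one_eq_minNorm_holds : successiveMinimum_one_eq_minNorm (E := E) := by
  intro _ L
  -- membership in the set defining `λ₁(L)`
  have hS : ∀ r : ℝ,
      (0 ≤ r ∧ 1 ≤ finrank ℝ (Submodule.span ℝ ((L : Set E) ∩ closedBall (0 : E) r))) ↔
        ∃ x ∈ L, x ≠ 0 ∧ ‖x‖ ≤ r := by
    intro r
    rw [Submodule.one_le_finrank_iff, ne_eq, Submodule.span_eq_bot]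
    push Not
    constructor
    · rintro ⟨-, x, ⟨hxL, hxr⟩, hx0⟩
      exact ⟨x, hxL, hx0, mem_closedBall_zero_iff.1 hxr⟩
    · rintro ⟨x, hxL, hx0, hxr⟩
      exact ⟨(norm_nonneg x).trans hxr, x, ⟨hxL, mem_closedBall_zero_iff.2 hxr⟩, hx0⟩
  unfold successiveMinimum minNorm
  by_cases hL : ∃ x ∈ L, x ≠ 0
  · obtain ⟨x₀, hx₀L, hx₀⟩ := hL
    have hTbdd : BddBelow ((‖·‖) '' {x : E | x ∈ L ∧ x ≠ 0}) :=
      ⟨0, by rintro _ ⟨x, -, rfl⟩; exact norm_nonneg x⟩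
    have hSbdd : BddBelow {r : ℝ | 0 ≤ r ∧
        1 ≤ finrank ℝ (Submodule.span ℝ ((L : Set E) ∩ closedBall (0 : E) r))} :=
      ⟨0, fun r hr => hr.1⟩
    refine le_antisymm ?_ ?_
    · refine csInf_le_csInf hSbdd ⟨‖x₀‖, x₀, ⟨hx₀L, hx₀⟩, rfl⟩ ?_
      rintro _ ⟨x, ⟨hxL, hx⟩, rfl⟩
      exact (hS _).2 ⟨x, hxL, hx, le_rfl⟩
    · refine le_csInf ⟨‖x₀‖, (hS _).2 ⟨x₀, hx₀L, hx₀, le_rfl⟩⟩ ?_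
      intro r hr
      obtain ⟨x, hxL, hx, hxr⟩ := (hS r).1 hr
      exact (csInf_le hTbdd ⟨x, ⟨hxL, hx⟩, rfl⟩).trans hxr
  · push Not at hL
    have h1 : {r : ℝ | 0 ≤ r ∧
        1 ≤ finrank ℝ (Submodule.span ℝ ((L : Set E) ∩ closedBall (0 : E) r))} = ∅ := by
      ext r
      simp only [Set.mem_setOf_eq, Set.mem_empty_iff_false, iff_false]
      intro hr
      obtain ⟨x, hxL, hx, -⟩ := (hS r).1 hr
      exact hx (hL x hxL)
    have h2 : ((‖·‖) '' {x : E | x ∈ L ∧ x ≠ 0}) = ∅ := by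
      ext t
      simp only [Set.mem_image, Set.mem_setOf_eq, Set.mem_empty_iff_false, iff_false]
      rintro ⟨x, ⟨hxL, hx⟩, -⟩
      exact hx (hL x hxL)
    rw [h1, h2]

end Literature.Algebra.EuclideanLattices
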